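import Literature.NumberTheory.Sieve.SmoothRoughDecomposition
import Literature.NumberTheory.LFunctions.MertensFormula
import Mathlib.NumberTheory.Chebyshev
import Mathlib.Analysis.SpecialFunctions.Pow.Asymptotics
import Mathlib.Algebra.BigOperators.Fin
import Mathlib.Data.Fintype.BigOperators
import HarnessLib

/-!
# Rough numbers sorted by `Ω`: Chebyshev–Mertens tools for lower bounds (prime tuples in windows)

Topic `Literature/NumberTheory/Sieve`, next to `RoughOmegaCells.lean`. Everything here is PROVED
(no definitions, no named facts). The `Ω`-cells `{b ∈ roughIcc M X : Ω(b) = m}` of the rough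
numbers (`SmoothRoughDecomposition.lean`, `RoughOmegaCells.lean`) at roughness `M ≈ X^{1/u}` have
order `X / log X` for `1 ≤ m < u` (K. Alladi 1982: `∼ I_m(u) X/log X`; Tenenbaum III.6). This file
supplies the elementary inputs of the Chebyshev-strength LOWER bound by the classical explicit
sub-family `b = p₀ p₁ ⋯ p_{k-1} · q` (`k = m - 1`): primes `p_i` taken from disjoint windows
`(X^{e_i}, X^{e_{i+1}}]` and a last prime `q ∈ (X^{e_k}, X/(p₀ ⋯ p_{k-1})]`.

* `eventually_div_two_log_le_primeCounting` — Chebyshev: `x/(2 log x) ≤ π(x)` for large real `x`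
  (Mathlib's explicit `Chebyshev.pi_ge'` and `log x = o(x)`);
* `eventually_le_sum_inv_primes_rpow_window` — Mertens in a window: for `0 < a < b`,
  `∑_{N^a < p ≤ N^b} 1/p ≥ log(b/a)/2` for large `N` (`Mertens.abs_primeRecipSum_sub_le` twice);
* `primeFactorsList_prod_eq_ofFn` — unique factorisation for a strictly increasing tuple of primes:
  the prime-factor list of `∏ g_i` is `List.ofFn g`;
* `snoc_windows_facts` — for `t_i` prime in `(⌊N^{e_i}⌋, ⌊N^{e_{i+1}}⌋]` (`i < k`, `e` monotone)
  and a prime `q > ⌊N^{e_k}⌋`, the tuple `(t₀, …, t_{k-1}, q)` is strictly increasing, prime, and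
  its `i`-th entry exceeds `⌊N^{e_i}⌋`;
* `card_sigma_windows_le_card_roughIcc_filter` — **the injection**: `(t, q) ↦ (∏ t_i) q` maps the
  pairs (`t` in the window box, `q` prime in `(⌊N^{e_k}⌋, N / ∏ t_i]`) injectively into the cell
  `{b ∈ roughIcc (⌊N^{e_0}⌋ + 1) N : Ω(b) = k + 1}`, so the cell has at least
  `∑_t #{q}` elements.

## References

* K. Alladi, *The distribution of `ν(n)` in the sieve of Eratosthenes*, Quart. J. Math. Oxford (2)
  33 (1982) 129–148. [Alladi1982]
* G. Tenenbaum, *Introduction to analytic and probabilistic number theory*, 3rd ed., AMS (2015),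
  III.6. [Tenenbaum2015]
* G. H. Hardy, E. M. Wright, *An Introduction to the Theory of Numbers*, Thms 427–429 (Mertens).
  [HardyWright2008]
-/

noncomputable section

open Finset Filter ArithmeticFunction
open scoped ArithmeticFunction.Omega

namespace Literature.NumberTheory.Sieve

/-! ### Chebyshev's lower bound for `π` and Mertens' theorem in a window -/

/-- Chebyshev: `x/(2 log x) ≤ π(x)` for all large real `x` (from Mathlib's explicit
`Chebyshev.pi_ge'`, `((x-1) log 2 - log(x+2))/log x ≤ π(x)`, and `log x = o(x)`). [folklore] -/
theorem eventually_div_two_log_le_primeCounting :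
    ∀ᶠ x : ℝ in atTop, x / (2 * Real.log x) ≤ (Nat.primeCounting ⌊x⌋₊ : ℝ) := by
  filter_upwards [Real.isLittleO_log_id_atTop.bound (show (0 : ℝ) < 1 / 10 by norm_num),
    eventually_ge_atTop (16 : ℝ)] with x hx hx16
  have hx1 : (1 : ℝ) < x := by linarith
  have hlogx : 0 < Real.log x := Real.log_pos hx1
  simp only [id, Real.norm_eq_abs, abs_of_pos hlogx, abs_of_pos (by linarith : (0 : ℝ) < x)] at hx
  have hlog2 := Real.log_two_gt_d9
  have h2 : Real.log (x + 2) ≤ Real.log 2 + Real.log x := by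
    rw [← Real.log_mul (by norm_num) (by linarith)]
    exact Real.log_le_log (by linarith) (by linarith)
  have h3 : (x - 2) * 0.6931471803 ≤ (x - 2) * Real.log 2 :=
    mul_le_mul_of_nonneg_left hlog2.le (by linarith)
  refine le_trans ?_ (Chebyshev.pi_ge' hx1)
  rw [← div_div]
  apply div_le_div_of_nonneg_right _ hlogx.le
  linarith

/-- Mertens in a window: for `0 < a < b`, `∑_{N^a < p ≤ N^b} 1/p ≥ log(b/a)/2` for all large `N`
(Mertens' second theorem with its rate, Hardy–Wright Thm 427, at `N^a` and at `N^b`: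
`log log N^b - log log N^a = log(b/a)` and the two error terms are `≤ 16/(a log N)`). [folklore] -/
theorem eventually_le_sum_inv_primes_rpow_window {a b : ℝ} (ha : 0 < a) (hab : a < b) :
    ∀ᶠ N : ℕ in atTop, Real.log (b / a) / 2 ≤
      ∑ p ∈ (Finset.Ioc ⌊(N : ℝ) ^ a⌋₊ ⌊(N : ℝ) ^ b⌋₊).filter Nat.Prime, (1 : ℝ) / p := by
  have hb : 0 < b := ha.trans hab
  have hlba : 0 < Real.log (b / a) := Real.log_pos ((one_lt_div ha).2 hab)
  have h1 : Tendsto (fun N : ℕ => (N : ℝ) ^ a) atTop atTop :=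
    (tendsto_rpow_atTop ha).comp tendsto_natCast_atTop_atTop
  have h2 : Tendsto (fun N : ℕ => Real.log (N : ℝ)) atTop atTop :=
    Real.tendsto_log_atTop.comp tendsto_natCast_atTop_atTop
  filter_upwards [h1.eventually_ge_atTop 2, h2.eventually_ge_atTop (32 / (a * Real.log (b / a))),
    eventually_ge_atTop 2] with N hNa hlogN hN2
  change (2 : ℝ) ≤ (N : ℝ) ^ a at hNa
  change 32 / (a * Real.log (b / a)) ≤ Real.log N at hlogN
  have hN1 : (1 : ℝ) ≤ N := by exact_mod_cast (by omega : 1 ≤ N)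
  have hNpos : (0 : ℝ) < N := by linarith
  have hlogN0 : 0 < Real.log N := Real.log_pos (by exact_mod_cast (by omega : 1 < N))
  have hNab : (N : ℝ) ^ a ≤ (N : ℝ) ^ b := Real.rpow_le_rpow_of_exponent_le hN1 hab.le
  have hMa := Literature.NumberTheory.LFunctions.Mertens.abs_primeRecipSum_sub_le hNa
  have hMb := Literature.NumberTheory.LFunctions.Mertens.abs_primeRecipSum_sub_le (hNa.trans hNab)
  have hsplit : Literature.NumberTheory.LFunctions.Mertens.primeRecipSum ((N : ℝ) ^ b) =
      Literature.NumberTheory.LFunctions.Mertens.primeRecipSum ((N : ℝ) ^ a) +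
        ∑ p ∈ (Finset.Ioc ⌊(N : ℝ) ^ a⌋₊ ⌊(N : ℝ) ^ b⌋₊).filter Nat.Prime, (1 : ℝ) / p := by
    simp only [Literature.NumberTheory.LFunctions.Mertens.primeRecipSum,
      Nat.primesLE_eq_filter_Ioc_zero, one_div]
    rw [← Finset.Ioc_union_Ioc_eq_Ioc (Nat.zero_le _) (Nat.floor_le_floor hNab),
      Finset.filter_union, Finset.sum_union]
    refine Finset.disjoint_left.2 fun p hp hp' => ?_
    rw [Finset.mem_filter, Finset.mem_Ioc] at hp hp'
    omega
  have hloga : Real.log ((N : ℝ) ^ a) = a * Real.log N := Real.log_rpow hNpos a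
  have hlogb : Real.log ((N : ℝ) ^ b) = b * Real.log N := Real.log_rpow hNpos b
  have hll : Real.log (Real.log ((N : ℝ) ^ b)) - Real.log (Real.log ((N : ℝ) ^ a)) =
      Real.log (b / a) := by
    rw [hloga, hlogb, Real.log_mul hb.ne' hlogN0.ne', Real.log_mul ha.ne' hlogN0.ne',
      Real.log_div hb.ne' ha.ne']
    ring
  have h32 : 32 ≤ Real.log N * (a * Real.log (b / a)) := (div_le_iff₀ (by positivity)).1 hlogN
  have hmono : Real.log (b / a) * (a * Real.log N) ≤ Real.log (b / a) * (b * Real.log N) :=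
    mul_le_mul_of_nonneg_left (mul_le_mul_of_nonneg_right hab.le hlogN0.le) hlba.le
  have hEa : 8 / Real.log ((N : ℝ) ^ a) ≤ Real.log (b / a) / 4 := by
    rw [hloga, div_le_div_iff₀ (by positivity) (by norm_num : (0 : ℝ) < 4)]
    nlinarith
  have hEb : 8 / Real.log ((N : ℝ) ^ b) ≤ Real.log (b / a) / 4 := by
    rw [hlogb, div_le_div_iff₀ (by positivity) (by norm_num : (0 : ℝ) < 4)]
    nlinarith
  rw [abs_le] at hMa hMb
  linarith [hMa.2, hMb.1]

/-! ### Strictly increasing tuples of primes -/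

/-- Unique factorisation for a strictly increasing tuple of primes: the prime-factor list of
`∏ g i` is `List.ofFn g` (both are sorted and have the same product). [folklore] -/
theorem primeFactorsList_prod_eq_ofFn {n : ℕ} {g : Fin n → ℕ} (hg : StrictMono g)
    (hp : ∀ i, (g i).Prime) : (∏ i, g i).primeFactorsList = List.ofFn g := by
  symm
  refine List.Perm.eq_of_sortedLE (List.sortedLE_ofFn_iff.2 hg.monotone)
    (Nat.primeFactorsList_sorted _) (Nat.primeFactorsList_unique List.prod_ofFn fun p hp' => ?_)
  obtain ⟨i, rfl⟩ := List.mem_ofFn.1 hp'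
  exact hp i

/-- The tuples of the window sub-family: if `t_i` is a prime in `(⌊N^{e_i}⌋, ⌊N^{e_{i+1}}⌋]` for
`i < k` and `q > ⌊N^{e_k}⌋` is prime (`e` monotone, `N ≥ 1`), then `(t₀, …, t_{k-1}, q)` is a
strictly increasing tuple of primes whose `i`-th entry exceeds `⌊N^{e_i}⌋`. [folklore] -/
theorem snoc_windows_facts {N k : ℕ} {e : ℕ → ℝ} (he : Monotone e) (hN : 1 ≤ N)
    {t : Fin k → ℕ} {q : ℕ}
    (ht : ∀ i : Fin k, (t i).Prime ∧ ⌊(N : ℝ) ^ e i⌋₊ < t i ∧ t i ≤ ⌊(N : ℝ) ^ e ((i : ℕ) + 1)⌋₊)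
    (hq : q.Prime ∧ ⌊(N : ℝ) ^ e k⌋₊ < q) :
    StrictMono (Fin.snoc t q : Fin (k + 1) → ℕ) ∧
      (∀ i, ((Fin.snoc t q : Fin (k + 1) → ℕ) i).Prime) ∧
      (∀ i : Fin (k + 1), ⌊(N : ℝ) ^ e i⌋₊ < (Fin.snoc t q : Fin (k + 1) → ℕ) i) := by
  have hfl : ∀ i j : ℕ, i ≤ j → ⌊(N : ℝ) ^ e i⌋₊ ≤ ⌊(N : ℝ) ^ e j⌋₊ := fun i j hij =>
    Nat.floor_le_floor (Real.rpow_le_rpow_of_exponent_le (by exact_mod_cast hN) (he hij))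
  refine ⟨Fin.strictMono_iff_lt_succ.2 fun i => ?_, fun i => ?_, fun i => ?_⟩
  · rw [Fin.snoc_castSucc]
    rcases Fin.eq_castSucc_or_eq_last i.succ with ⟨j, hj⟩ | hj
    · rw [hj, Fin.snoc_castSucc]
      have hij : (i : ℕ) + 1 = j := by
        have h := congrArg Fin.val hj
        simpa using h
      calc t i ≤ ⌊(N : ℝ) ^ e ((i : ℕ) + 1)⌋₊ := (ht i).2.2
        _ = ⌊(N : ℝ) ^ e j⌋₊ := by rw [hij]
        _ < t j := (ht j).2.1
    · rw [hj, Fin.snoc_last]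
      calc t i ≤ ⌊(N : ℝ) ^ e ((i : ℕ) + 1)⌋₊ := (ht i).2.2
        _ ≤ ⌊(N : ℝ) ^ e k⌋₊ := hfl _ _ i.isLt
        _ < q := hq.2
  · rcases Fin.eq_castSucc_or_eq_last i with ⟨j, rfl⟩ | rfl
    · rw [Fin.snoc_castSucc]; exact (ht j).1
    · rw [Fin.snoc_last]; exact hq.1
  · rcases Fin.eq_castSucc_or_eq_last i with ⟨j, rfl⟩ | rfl
    · rw [Fin.snoc_castSucc, Fin.val_castSucc]; exact (ht j).2.1
    · rw [Fin.snoc_last, Fin.val_last]; exact hq.2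

/-! ### The window sub-family injects into the `Ω`-cell -/

/-- **The injection.** For monotone exponents `e` and `N ≥ 1`, the pairs `(t, q)` — `t` in the
window box `∏_{i<k} {p prime : ⌊N^{e_i}⌋ < p ≤ ⌊N^{e_{i+1}}⌋}`, `q` prime with
`⌊N^{e_k}⌋ < q ≤ N / ∏ t_i` — are mapped injectively by `(t, q) ↦ (∏ t_i) · q` into the cell
`{b ∈ roughIcc (⌊N^{e_0}⌋ + 1) N : Ω(b) = k + 1}` (unique factorisation: the sorted prime-factor
list of the image is the tuple itself), so the cell has at least `∑_t #{q}` elements.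
[folklore] -/
theorem card_sigma_windows_le_card_roughIcc_filter {N k : ℕ} {e : ℕ → ℝ} (he : Monotone e)
    (hN : 1 ≤ N) (W : Fin k → Finset ℕ) (Q : (Fin k → ℕ) → Finset ℕ)
    (hW : ∀ i, W i = (Finset.Ioc ⌊(N : ℝ) ^ e i⌋₊ ⌊(N : ℝ) ^ e ((i : ℕ) + 1)⌋₊).filter Nat.Prime)
    (hQ : ∀ t, Q t = (Finset.Ioc ⌊(N : ℝ) ^ e k⌋₊ (N / ∏ i, t i)).filter Nat.Prime) :
    ((Fintype.piFinset W).sigma Q).card ≤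
      ((roughIcc (⌊(N : ℝ) ^ e 0⌋₊ + 1) N).filter (fun b => Ω b = k + 1)).card := by
  have hmem : ∀ x ∈ (Fintype.piFinset W).sigma Q,
      (∀ i : Fin k, (x.1 i).Prime ∧ ⌊(N : ℝ) ^ e i⌋₊ < x.1 i ∧
        x.1 i ≤ ⌊(N : ℝ) ^ e ((i : ℕ) + 1)⌋₊) ∧
      (x.2.Prime ∧ ⌊(N : ℝ) ^ e k⌋₊ < x.2) ∧ x.2 ≤ N / ∏ i, x.1 i := by
    intro x hx
    rw [Finset.mem_sigma, Fintype.mem_piFinset, hQ, Finset.mem_filter, Finset.mem_Ioc] at hx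
    refine ⟨fun i => ?_, ⟨hx.2.2, hx.2.1.1⟩, hx.2.1.2⟩
    have h := hx.1 i
    rw [hW, Finset.mem_filter, Finset.mem_Ioc] at h
    exact ⟨h.2, h.1.1, h.1.2⟩
  have hfl : ∀ i : ℕ, ⌊(N : ℝ) ^ e 0⌋₊ ≤ ⌊(N : ℝ) ^ e i⌋₊ := fun i =>
    Nat.floor_le_floor (Real.rpow_le_rpow_of_exponent_le (by exact_mod_cast hN)
      (he (Nat.zero_le i)))
  refine Finset.card_le_card_of_injOn (fun x => (∏ i, x.1 i) * x.2) (fun x hx => ?_)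
    (fun x hx x' hx' hxx' => ?_)
  · rw [Finset.mem_coe] at hx
    obtain ⟨ht, hq, hqN⟩ := hmem x hx
    obtain ⟨hmono, hprime, hfloor⟩ := snoc_windows_facts he hN ht hq
    have hprod : (∏ i, x.1 i) * x.2 = ∏ i, (Fin.snoc x.1 x.2 : Fin (k + 1) → ℕ) i :=
      (Fin.prod_snoc _ _).symm
    set g : Fin (k + 1) → ℕ := Fin.snoc x.1 x.2 with hg
    have hkey := primeFactorsList_prod_eq_ofFn hmono hprime
    have hn0 : (∏ i, g i) ≠ 0 := Finset.prod_ne_zero_iff.2 fun i _ => (hprime i).ne_zero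
    have hP : 0 < ∏ i, x.1 i := Finset.prod_pos fun i _ => (ht i).1.pos
    show (∏ i, x.1 i) * x.2 ∈ (((roughIcc (⌊(N : ℝ) ^ e 0⌋₊ + 1) N).filter
      (fun b => Ω b = k + 1)) : Set ℕ)
    rw [Finset.mem_coe, Finset.mem_filter, mem_roughIcc, hprod]
    refine ⟨⟨⟨Nat.pos_of_ne_zero hn0, ?_⟩, fun p hp hpn => ?_⟩, ?_⟩
    · rw [← hprod, mul_comm]; exact (Nat.le_div_iff_mul_le hP).1 hqN
    · have hm : p ∈ (∏ i, g i).primeFactorsList := (Nat.mem_primeFactorsList hn0).2 ⟨hp, hpn⟩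
      rw [hkey, List.mem_ofFn] at hm
      obtain ⟨i, rfl⟩ := hm
      exact (hfl i).trans_lt (hfloor i)
    · rw [cardFactors_apply, hkey, List.length_ofFn]
  · rw [Finset.mem_coe] at hx hx'
    obtain ⟨ht, hq, -⟩ := hmem x hx
    obtain ⟨ht', hq', -⟩ := hmem x' hx'
    obtain ⟨hmono, hprime, -⟩ := snoc_windows_facts he hN ht hq
    obtain ⟨hmono', hprime', -⟩ := snoc_windows_facts he hN ht' hq'
    have h1 := primeFactorsList_prod_eq_ofFn hmono hprime
    have h2 := primeFactorsList_prod_eq_ofFn hmono' hprime'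
    simp only [Fin.prod_snoc] at h1 h2
    dsimp only at hxx'
    rw [hxx'] at h1
    have h3 := Fin.snoc_inj.1 (List.ofFn_injective (h1.symm.trans h2))
    exact Sigma.ext h3.1 (heq_of_eq h3.2)

end Literature.NumberTheory.Sieve

end
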